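import Summits.NavierStokesRegularity.NavierStokesRegularity.Theorems.SelfMixingDichotomyMixingPayoffAdvectionDiffusionSmoothStep
import Summits.NavierStokesRegularity.NavierStokesRegularity.Theorems.SelfMixingDichotomyMixingPayoffAdvectionDiffusionClock
import HarnessLib

/-!
# Crux `MixingPayoff` (stmt-NavierStokesRegularity-1422), line `birth`, stub W2
  (`stub_advectionDiffusionSchwartz`): one time window of the linear equation
  `∂ₜψ = Δψ + ⟪β, ∇ψ⟫ + γψ` with `C_b^∞` coefficients

Helper file (lands `--supports stmt-NavierStokesRegularity-1422`). For `β`, `γ` jointly `C^∞`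
on `ℝ × E` with all derivatives bounded there is ONE window length `T ∈ (0, 1]` (explicit in
the first-order bounds of the clock system on the ball of radius `|L| + 2`) such that from every
initial time `t₀ ∈ [-L, L]` and every datum with all derivatives bounded the equation has a
smooth solution on `[t₀, t₀ + T) × E` with quantitative by-products (`linear_step`): the
autonomous clock system (`…AdvectionDiffusionClock`) is solved by `smooth_step` after
normalising the datum, and the clock component is identified as `t₀ + s` through the mild
formula (`e^{sΔ}c = c`).
-/

noncomputable section

open MeasureTheory Set Function Filter Metric Real
open _root_.Topology
open scoped ENNReal NNReal ContDiff Laplacian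

-- `Summit = Problem` for this summit; the tree lakefile sets `weak.linter.dupNamespace = false`.
set_option linter.dupNamespace false

namespace Summit.NavierStokesRegularity.NavierStokesRegularity.Theorems.SelfMixingDichotomy.MixingPayoffBirth

open Literature.Analysis.UnboundedOperators Literature.Analysis.UnboundedOperators.HeatHolder
open Literature.Analysis.FluidPDE Literature.Analysis.PDE.SemilinearHeat
open Literature.Analysis.Calculus (natCast_le_infty)

-- nested operator types `E →L[ℝ] E →L[ℝ] V`
set_option maxSynthPendingDepth 3

section Step

variable {E : Type} [NormedAddCommGroup E] [InnerProductSpace ℝ E] [FiniteDimensional ℝ E]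
  [MeasurableSpace E] [BorelSpace E]
variable {β : ℝ → E → E} {γ : ℝ → E → ℝ}
set_option maxHeartbeats 800000 in
/-- **One window of the linear equation `∂ₜψ = Δψ + ⟪β, ∇ψ⟫ + γψ` with `C_b^∞` coefficients.**
For `β`, `γ` jointly `C^∞` on `ℝ × E` with all derivatives bounded there is a window length
`T ∈ (0, 1]` such that for every initial time `t₀ ∈ [-L, L]` and every datum `ϑ` with all
derivatives bounded there is `ψ` on `[t₀, t₀ + T)`, jointly `C^∞` on `[t₀, t₀ + T) × E`, solving
the equation on `(t₀, t₀ + T)`, with `ψ(t₀) = ϑ`, bounded, all slices bounded in every `Cⁿ`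
uniformly, and all spatial derivatives jointly continuous on `[t₀, t₀ + T] × E`. Proof: the
autonomous system for the pair `(ψ/Λ, clock)` (`clock_contDiff`, `clock_bounds`) is solved by
`smooth_step`; the clock component is `t₀ + s` by the mild formula (`e^{sΔ}1 = 1`). -/
theorem linear_step (hβ : ContDiff ℝ ∞ (uncurry β)) (hγ : ContDiff ℝ ∞ (uncurry γ))
    (hβb : ∀ n, ∃ C, ∀ p, ‖iteratedFDeriv ℝ n (uncurry β) p‖ ≤ C)
    (hγb : ∀ n, ∃ C, ∀ p, ‖iteratedFDeriv ℝ n (uncurry γ) p‖ ≤ C) (L : ℝ) :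
    ∃ T : ℝ, 0 < T ∧ T ≤ 1 ∧ ∀ t₀ ∈ Icc (-L) L, ∀ ϑ : E → ℝ, (∀ n, ∃ A, IsCkBounded n A ϑ) →
      ∃ ψ : ℝ → E → ℝ, ψ t₀ = ϑ ∧
        ContDiffOn ℝ ∞ (uncurry ψ) (Ico t₀ (t₀ + T) ×ˢ univ) ∧
        (∀ t ∈ Ioo t₀ (t₀ + T), ∀ x, HasDerivAt (fun s => ψ s x)
          ((Δ (ψ t)) x + fderiv ℝ (ψ t) x (β t x) + γ t x * ψ t x) t) ∧
        (∃ M, ∀ t x, |ψ t x| ≤ M) ∧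
        (∀ n, ∃ A, ∀ t ∈ Icc t₀ (t₀ + T), IsCkBounded n A (ψ t)) ∧
        (∀ k, ContinuousOn (fun p : ℝ × E => iteratedFDeriv ℝ k (ψ p.1) p.2)
          (Icc t₀ (t₀ + T) ×ˢ univ)) := by
  classical
  -- the clock system
  set F : E × (ℝ × ℝ) × (E →L[ℝ] ℝ × ℝ) → ℝ × ℝ := fun q =>
    ((q.2.2 (β q.2.1.2 q.1)).1 + γ q.2.1.2 q.1 * q.2.1.1, 1) with hF
  have hFs : ContDiff ℝ ∞ F := clock_contDiff hβ hγ hF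
  have hFb := clock_bounds hβ hγ hβb hγb hF
  -- the constants
  set R : ℝ := |L| + 2 with hR
  obtain ⟨B₁, hB₁0, hB₁⟩ := hFb 1 R
  set c : ℝ := (2 : ℝ) ^ ((Module.finrank ℝ E : ℝ) / 2) with hc
  set T : ℝ := (min (1 / (4 * c * (B₁ + 1))) (1 / (2 * c * B₁ + 1))) ^ 2 with hT
  have hc1 : 1 ≤ c := Real.one_le_rpow (by norm_num) (by positivity)
  obtain ⟨hδ0, hδle, -⟩ := smallness_constants hc1 hB₁0 hB₁0 rfl
  have hT0 : 0 < T := by rw [hT]; positivity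
  have hT1 : T ≤ 1 := by rw [hT]; nlinarith
  refine ⟨T, hT0, hT1, fun t₀ ht₀ ϑ hϑ => ?_⟩
  -- normalisation of the datum
  obtain ⟨A, hA⟩ := hϑ 1
  set Λ : ℝ := A + 1 with hΛ
  have hΛ0 : 0 < Λ := by have := hA.nonneg; rw [hΛ]; linarith
  set U₀ : E → ℝ × ℝ := fun x => (Λ⁻¹ * ϑ x, t₀) with hU₀
  have hϑs : ContDiff ℝ ∞ ϑ := contDiff_infty.2 fun n => by
    obtain ⟨A', hA'⟩ := hϑ n; exact hA'.contDiff
  have hU₀eq : U₀ = fun x => ((fun y => Λ⁻¹ * ϑ y) x, (fun _ : E => t₀) x) := rfl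
  have hDU₀ : ∀ (j : ℕ) (x : E), ‖iteratedFDeriv ℝ j U₀ x‖ ≤
      Λ⁻¹ * ‖iteratedFDeriv ℝ j ϑ x‖ + |t₀| := by
    intro j x
    rw [hU₀eq, iteratedFDeriv_prodMk ((contDiff_const.mul hϑs).contDiffAt.of_le (mod_cast le_top))
      (contDiff_const.contDiffAt.of_le (mod_cast le_top)) le_rfl, ContinuousMultilinearMap.opNorm_prod]
    refine max_le (le_add_of_le_of_nonneg ?_ (abs_nonneg _)) (le_add_of_nonneg_of_le (by positivity) ?_)
    · rw [show (fun y => Λ⁻¹ * ϑ y) = Λ⁻¹ • ϑ from rfl, iteratedFDeriv_const_smul_apply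
        (hϑs.contDiffAt.of_le (mod_cast le_top)), norm_smul, Real.norm_eq_abs, abs_of_pos (inv_pos.2 hΛ0)]
    · rcases j with _ | j
      · simp
      · rw [iteratedFDeriv_const_of_ne (by omega)]; simp
  have hU₀b : ∀ n, ∃ A', IsCkBounded n A' U₀ := fun n => by
    obtain ⟨A', hA'⟩ := hϑ n
    refine ⟨Λ⁻¹ * A' + |t₀|, ((contDiff_const.mul hϑs).prodMk contDiff_const).of_le
      (natCast_le_infty n), fun j hj x => (hDU₀ j x).trans ?_⟩
    gcongr; exact hA'.norm_le j hj x
  have hU₀1 : IsCkBounded 1 (1 + |L|) U₀ := by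
    refine ⟨((contDiff_const.mul hϑs).prodMk contDiff_const).of_le (natCast_le_infty 1),
      fun j hj x => (hDU₀ j x).trans (add_le_add ?_ (abs_le_abs ht₀.2 (by linarith [ht₀.1])))⟩
    calc Λ⁻¹ * ‖iteratedFDeriv ℝ j ϑ x‖ ≤ Λ⁻¹ * A := by gcongr; exact hA.norm_le j hj x
      _ ≤ 1 := by rw [inv_mul_le_iff₀ hΛ0, hΛ]; linarith
  have hRA : (1 + |L|) + 1 ≤ R := by rw [hR]; linarith
  -- the solution of the clock system
  obtain ⟨-, -, u, hu0, hus, hueq, huR, husl, hucont, humild, hgm, hgc, hgM⟩ :=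
    smooth_step F hFs hFb hB₁0 hB₁ hT U₀ hU₀b hU₀1 hRA
  -- ### the clock component
  have hclock : ∀ s ∈ Icc 0 T, ∀ x, (u s x).2 = t₀ + s := by
    intro s hs x
    rcases eq_or_lt_of_le hs.1 with h0 | h0
    · subst h0; simp [hu0, hU₀]
    have hsI : s ∈ Ioc 0 T := ⟨h0, hs.2⟩
    have h := congrArg Prod.snd (humild s hsI x)
    rw [h, Prod.snd_add]
    have h1 : (heatExtension U₀ s x).2 = t₀ := by
      have hc : Continuous U₀ := (continuous_const.mul hϑs.continuous).prodMk continuous_const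
      obtain ⟨A', hA'⟩ := hU₀b 0
      have := heatExtension_clm_comp_of_bound (ContinuousLinearMap.snd ℝ ℝ ℝ) hc
        (fun z => hA'.norm_apply_le z) h0 x
      simp only [ContinuousLinearMap.coe_snd'] at this
      rw [← this]
      exact heatExtension_const t₀ h0 x
    have h2 : (∫ r in Ioo 0 s, heatExtension (fun y => F (y, u r y, fderiv ℝ (u r) y)) (s - r) x).2 =
        s := by
      have hint := integrableOn_lift_apply hgm hgM s x
      have hcomm := ((ContinuousLinearMap.snd ℝ ℝ ℝ).integral_comp_comm hint).symm
      simp only [ContinuousLinearMap.coe_snd'] at hcomm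
      rw [hcomm]
      have h3 : ∀ r ∈ Ioo 0 s, (heatExtension (fun y => F (y, u r y, fderiv ℝ (u r) y)) (s - r) x).2 =
          (1 : ℝ) := by
        intro r hr
        have := heatExtension_clm_comp_of_bound (ContinuousLinearMap.snd ℝ ℝ ℝ) (hgc r)
          (fun z => hgM r z) (sub_pos.2 hr.2) x
        simp only [ContinuousLinearMap.coe_snd'] at this
        rw [← this]
        exact heatExtension_const (1 : ℝ) (sub_pos.2 hr.2) x
      rw [setIntegral_congr_fun measurableSet_Ioo h3, setIntegral_const,
        HeatHolder.volume_real_Ioo h0.le, smul_eq_mul, mul_one]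
    rw [h1, h2]
  -- ### the solution
  set Lc : ℝ × ℝ →L[ℝ] ℝ := Λ • ContinuousLinearMap.fst ℝ ℝ ℝ with hLc
  have hLc_apply : ∀ v : ℝ × ℝ, Lc v = Λ * v.1 := fun v => by simp [hLc]
  set ψ : ℝ → E → ℝ := fun t x => Λ * (u (t - t₀) x).1 with hψ
  have hψL : ∀ t, ψ t = Lc ∘ u (t - t₀) := fun t => funext fun x => by simp [hψ, hLc_apply]
  have hsm : ∀ s ∈ Icc 0 T, ContDiff ℝ ∞ (u s) := fun s hs => contDiff_infty.2 fun n => by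
    obtain ⟨A', hA'⟩ := husl n; exact (hA' s hs).contDiff
  refine ⟨ψ, ?_, ?_, ?_, ?_, ?_, ?_⟩
  · -- initial datum
    funext x
    simp only [hψ, sub_self, hu0, hU₀]
    field_simp
  · -- joint smoothness
    have hmap : ContDiffOn ℝ ∞ (fun p : ℝ × E => ((p.1 - t₀, p.2) : ℝ × E)) (Ico t₀ (t₀ + T) ×ˢ univ) :=
      ((contDiff_fst.sub contDiff_const).prodMk contDiff_snd).contDiffOn
    have hmaps : MapsTo (fun p : ℝ × E => ((p.1 - t₀, p.2) : ℝ × E)) (Ico t₀ (t₀ + T) ×ˢ univ)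
        (Ico 0 T ×ˢ univ) := fun p hp => ⟨⟨by linarith [hp.1.1], by linarith [hp.1.2]⟩, mem_univ _⟩
    have h := (Lc.contDiff.comp_contDiffOn (hus.comp hmap hmaps))
    refine h.congr fun p _ => ?_
    simp [hψ, uncurry, hLc_apply]
  · -- the equation
    intro t ht x
    have hs : t - t₀ ∈ Ioo 0 T := ⟨by linarith [ht.1], by linarith [ht.2]⟩
    have hsI : t - t₀ ∈ Icc 0 T := ⟨hs.1.le, hs.2.le⟩
    have h1 := hueq (t - t₀) hs x
    have h2 : HasDerivAt (fun s => u (s - t₀) x)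
        ((Δ (u (t - t₀))) x + F (x, u (t - t₀) x, fderiv ℝ (u (t - t₀)) x)) t :=
      h1.comp_sub_const t t₀
    have h3 := (Lc.hasFDerivAt.comp_hasDerivAt t h2)
    have h4 : HasDerivAt (fun s => ψ s x)
        (Lc ((Δ (u (t - t₀))) x + F (x, u (t - t₀) x, fderiv ℝ (u (t - t₀)) x))) t := by
      refine h3.congr_of_eventuallyEq (Eventually.of_forall fun s => ?_)
      simp [hψ, hLc_apply]
    convert h4 using 1
    have hc2 : ContDiffAt ℝ 2 (u (t - t₀)) x := ((hsm _ hsI).of_le (natCast_le_infty 2)).contDiffAt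
    have hΔ : (Δ (ψ t)) x = Lc ((Δ (u (t - t₀))) x) := by
      rw [hψL t, hc2.laplacian_CLM_comp_left]
      rfl
    have hD : fderiv ℝ (ψ t) x (β t x) = Lc (fderiv ℝ (u (t - t₀)) x (β t x)) := by
      rw [hψL t, (Lc.hasFDerivAt.comp x (hc2.differentiableAt (by norm_num)).hasFDerivAt).fderiv]
      rfl
    rw [hΔ, hD, map_add, hLc_apply, hLc_apply, hLc_apply]
    have hcl : (u (t - t₀) x).2 = t := by rw [hclock _ hsI]; ring
    simp only [hF, hcl, hψ]
    ring
  · -- boundedness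
    refine ⟨Λ * R, fun t x => ?_⟩
    rw [hψ]
    simp only [abs_mul, abs_of_pos hΛ0]
    gcongr
    exact (Real.norm_eq_abs _ ▸ norm_fst_le (u (t - t₀) x)).trans (huR _ x).1
  · -- slices bounded in every `Cⁿ`
    intro n
    obtain ⟨A', hA'⟩ := husl n
    refine ⟨‖Lc‖ * A', fun t ht => ?_⟩
    have hsI : t - t₀ ∈ Icc 0 T := ⟨by linarith [ht.1], by linarith [ht.2]⟩
    refine ⟨?_, fun j hj x => ?_⟩
    · rw [hψL t]; exact Lc.contDiff.comp ((hA' _ hsI).contDiff)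
    · rw [hψL t]
      refine (Lc.norm_iteratedFDeriv_comp_left (((hA' _ hsI).contDiff).contDiffAt) (n := j)
        (mod_cast hj)).trans ?_
      gcongr; exact (hA' _ hsI).norm_le j hj x
  · -- joint continuity of the spatial derivatives
    intro k
    have hmaps : MapsTo (fun p : ℝ × E => ((p.1 - t₀, p.2) : ℝ × E)) (Icc t₀ (t₀ + T) ×ˢ univ)
        (Icc 0 T ×ˢ univ) := fun p hp => ⟨⟨by linarith [hp.1.1], by linarith [hp.1.2]⟩, mem_univ _⟩
    have h := ((Lc.compContinuousMultilinearMapL ℝ (fun _ : Fin k => E) (ℝ × ℝ) ℝ).continuous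
      |>.comp_continuousOn ((hucont k).comp ((continuous_fst.sub continuous_const).prodMk
        continuous_snd).continuousOn hmaps))
    refine h.congr fun p hp => ?_
    have hsI : p.1 - t₀ ∈ Icc 0 T := ⟨by linarith [hp.1.1], by linarith [hp.1.2]⟩
    simp only [comp_apply, ContinuousLinearMap.compContinuousMultilinearMapL_apply]
    rw [hψL p.1, Lc.iteratedFDeriv_comp_left ((hsm _ hsI).contDiffAt) (natCast_le_infty k)]
    rfl


/-- Anchor (registered sub-stub of stub W2): `linear_step` in closed form. -/
theorem w2aux_linearStep : ∀ {E : Type} [NormedAddCommGroup E] [InnerProductSpace ℝ E]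
    [FiniteDimensional ℝ E] [MeasurableSpace E] [BorelSpace E] {β : ℝ → E → E} {γ : ℝ → E → ℝ},
    ContDiff ℝ ∞ (uncurry β) → ContDiff ℝ ∞ (uncurry γ) →
    (∀ n, ∃ C, ∀ p, ‖iteratedFDeriv ℝ n (uncurry β) p‖ ≤ C) →
    (∀ n, ∃ C, ∀ p, ‖iteratedFDeriv ℝ n (uncurry γ) p‖ ≤ C) → ∀ L : ℝ,
    ∃ T : ℝ, 0 < T ∧ T ≤ 1 ∧ ∀ t₀ ∈ Icc (-L) L, ∀ ϑ : E → ℝ, (∀ n, ∃ A, IsCkBounded n A ϑ) →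
      ∃ ψ : ℝ → E → ℝ, ψ t₀ = ϑ ∧
        ContDiffOn ℝ ∞ (uncurry ψ) (Ico t₀ (t₀ + T) ×ˢ univ) ∧
        (∀ t ∈ Ioo t₀ (t₀ + T), ∀ x, HasDerivAt (fun s => ψ s x)
          ((Δ (ψ t)) x + fderiv ℝ (ψ t) x (β t x) + γ t x * ψ t x) t) ∧
        (∃ M, ∀ t x, |ψ t x| ≤ M) ∧
        (∀ n, ∃ A, ∀ t ∈ Icc t₀ (t₀ + T), IsCkBounded n A (ψ t)) ∧
        (∀ k, ContinuousOn (fun p : ℝ × E => iteratedFDeriv ℝ k (ψ p.1) p.2)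
          (Icc t₀ (t₀ + T) ×ˢ univ)) :=
  fun hβ hγ hβb hγb L => linear_step hβ hγ hβb hγb L

end Step

end Summit.NavierStokesRegularity.NavierStokesRegularity.Theorems.SelfMixingDichotomy.MixingPayoffBirth

end
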